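import Literature.NumberTheory.Automorphic.ArchRankinSelbergTestVector
import Literature.NumberTheory.Automorphic.StandardTestFunGaussian
import Literature.Analysis.FunctionSpaces.GaussianSchwartz
import Mathlib.Analysis.Distribution.TemperateGrowth
import HarnessLib

/-!
# A polynomial-times-Gaussian on `K_∞ⁿ` is a combination of four NON-NEGATIVE Schwartz functions

Topic `NumberTheory/Automorphic`; namespace `Literature.NumberTheory.Automorphic`. Theorems only.

The archimedean test functions of Humphries–Jo's test vector theorem
(`HumphriesJo2024_archRankinSelberg_testVector`, `ArchRankinSelbergTestVector`) are
`Φ_∞(x) = P(x) e^{-‖T x‖²}` with `P` a COMPLEX polynomial in real linear coordinates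
(`IsArchPolyGaussian`), whereas the global Rankin–Selberg machinery of the tree
(`exists_entire_eq_mul_partialPairL_mul_setIntegral_pair`, `RankinSelbergIntegralEntire`, …) is
written for REAL NON-NEGATIVE test functions `Φ_∞ ≥ 0` whose complexification is a Schwartz function
of `x_∞` (`ofReal_thinTestFun_mem_piSchwartzBruhat`, `ofReal_standardTestFun_mem_piSchwartzBruhat`).
This file bridges the two by linearity (`IsArchPolyGaussian.exists_nonneg_schwartz_decomposition`):

  `Φ_∞ = (Φ₁ - Φ₂) + i (Φ₃ - Φ₄)`,  `Φ_j ≥ 0` continuous, `Φ_j = Ψ_j(x_∞)` with `Ψ_j ∈ 𝓢((K ⊗ ℝ)ⁿ, ℂ)`,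

with `Φ₁ = (Re P + B) G`, `Φ₂ = Φ₄ = B G`, `Φ₃ = (Im P + B) G`, where `G = e^{-‖T x‖²}` and
`B = C (1 + ‖T x‖²)^k ≥ |P|` is a polynomial bound for `P` (temperate growth of polynomials,
Mathlib `Function.HasTemperateGrowth`); each `Φ_j` is a temperate function times the Gaussian
Schwartz function (Mathlib `SchwartzMap.smulLeftCLM`, the tree's
`Literature.Analysis.FunctionSpaces.gaussianSchwartz`).

## References

* P. Humphries, Y. Jo, *Test vectors for archimedean period integrals*, Publ. Mat. 68 (2024),
  Prop. 5.2 (the test function `P(x) exp(-d_F π x ᵗx̄)`) [HumphriesJo2024].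
-/

noncomputable section

open MeasureTheory Measure NumberField NumberField.mixedEmbedding IsDedekindDomain Set Function
open scoped ENNReal NNReal Classical ComplexConjugate

namespace Literature.NumberTheory.Automorphic

section PolyGaussian

variable {n : ℕ} {K : Type} [Field K] [NumberField K]

/-- A complex polynomial in finitely many real continuous linear coordinates has temperate growth.
[folklore] -/
theorem hasTemperateGrowth_eval_clm {V : Type*} [NormedAddCommGroup V] [NormedSpace ℝ V] {N : ℕ}
    (L : Fin N → (V →L[ℝ] ℝ)) (q : MvPolynomial (Fin N) ℂ) :
    (fun x : V => MvPolynomial.eval (fun i => ((L i x : ℝ) : ℂ)) q).HasTemperateGrowth := by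
  induction q using MvPolynomial.induction_on with
  | C a =>
    simp only [MvPolynomial.eval_C]
    exact Function.HasTemperateGrowth.const a
  | add p q hp hq =>
    simp only [map_add]
    exact hp.add hq
  | mul_X p i hp =>
    simp only [map_mul, MvPolynomial.eval_X]
    refine hp.mul ?_
    exact Complex.hasTemperateGrowth_ofReal.comp (L i).hasTemperateGrowth

/-- A function of temperate growth is bounded by `C (1 + ‖x‖)^k` with `C ≥ 0`. [folklore] -/
theorem exists_norm_le_of_hasTemperateGrowth {V F : Type*} [NormedAddCommGroup V] [NormedSpace ℝ V]
    [NormedAddCommGroup F] [NormedSpace ℝ F] {f : V → F} (hf : f.HasTemperateGrowth) :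
    ∃ (k : ℕ) (C : ℝ), 0 ≤ C ∧ ∀ x, ‖f x‖ ≤ C * (1 + ‖x‖) ^ k := by
  obtain ⟨k, C, hC⟩ := hf.2 0
  refine ⟨k, max C 0, le_max_right _ _, fun x => ?_⟩
  have h := hC x
  rw [norm_iteratedFDeriv_zero] at h
  exact h.trans (mul_le_mul_of_nonneg_right (le_max_left _ _) (by positivity))

/-- **A polynomial times a Gaussian is a combination `(Φ₁ - Φ₂) + i (Φ₃ - Φ₄)` of four NON-NEGATIVE
continuous functions whose complexifications are Schwartz functions of `x_∞`.**
[cite: HumphriesJo2024, Prop. 5.2] -/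
theorem IsArchPolyGaussian.exists_nonneg_schwartz_decomposition {Φ : (Fin n → InfiniteAdeleRing K) → ℂ}
    (hΦ : IsArchPolyGaussian n K Φ) :
    ∃ Φ₁ Φ₂ Φ₃ Φ₄ : (Fin n → InfiniteAdeleRing K) → ℝ,
      (∀ Ψ ∈ [Φ₁, Φ₂, Φ₃, Φ₄], Continuous Ψ ∧ (∀ z, 0 ≤ Ψ z) ∧
        ∃ S : SchwartzMap (Fin n → mixedSpace K) ℂ, ∀ z : Fin n → InfiniteAdeleRing K,
          ((Ψ z : ℝ) : ℂ) = S fun j => InfiniteAdeleRing.ringEquiv_mixedSpace K (z j)) ∧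
      ∀ z, Φ z = (((Φ₁ z : ℝ) : ℂ) - Φ₂ z) + Complex.I * (((Φ₃ z : ℝ) : ℂ) - Φ₄ z) := by
  obtain ⟨N, L, q, T, hΦ⟩ := hΦ
  -- coordinates, polynomial, Gaussian
  set xo : (Fin n → InfiniteAdeleRing K) → (Fin n → mixedSpace K) :=
    fun z j => InfiniteAdeleRing.ringEquiv_mixedSpace K (z j) with hxo
  have hxoc : Continuous xo := continuous_pi fun j => (continuous_ringEquiv_mixedSpace K).comp (continuous_apply j)
  set P : (Fin n → mixedSpace K) → ℂ := fun x => MvPolynomial.eval (fun i => ((L i x : ℝ) : ℂ)) q with hP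
  have hPt : P.HasTemperateGrowth := hasTemperateGrowth_eval_clm L q
  have hPc : Continuous P := hPt.1.continuous
  set G : (Fin n → mixedSpace K) → ℝ := fun x => Real.exp (-‖T x‖ ^ 2) with hG
  have hGc : Continuous G := Real.continuous_exp.comp ((T.continuous.norm.pow 2).neg)
  have hG0 : ∀ x, 0 ≤ G x := fun x => (Real.exp_pos _).le
  -- a polynomial bound `B ≥ |P|`
  obtain ⟨k, C, hC0, hCb⟩ := exists_norm_le_of_hasTemperateGrowth hPt
  set Ti : EuclideanSpace ℝ (Fin (Module.finrank ℝ (Fin n → mixedSpace K))) →L[ℝ] (Fin n → mixedSpace K) :=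
    T.symm.toContinuousLinearMap with hTi
  have hTia : ∀ x : Fin n → mixedSpace K, Ti (T x) = x := fun x => T.symm_apply_apply x
  set a : ℝ := max 1 ‖Ti‖ with ha
  have ha1 : 1 ≤ a := le_max_left _ _
  have hxle : ∀ x : Fin n → mixedSpace K, ‖x‖ ≤ a * ‖T x‖ := fun x => by
    calc ‖x‖ = ‖Ti (T x)‖ := by rw [hTia]
      _ ≤ ‖Ti‖ * ‖T x‖ := ContinuousLinearMap.le_opNorm _ _
      _ ≤ a * ‖T x‖ := mul_le_mul_of_nonneg_right (le_max_right _ _) (norm_nonneg _)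
  set B : (Fin n → mixedSpace K) → ℝ := fun x => C * (2 * a) ^ k * (1 + ‖T x‖ ^ 2) ^ k with hB
  have hBr : B.HasTemperateGrowth := by
    have h0 : (fun x : Fin n → mixedSpace K => ‖T x‖ ^ 2).HasTemperateGrowth :=
      Function.HasTemperateGrowth.comp
        (g := fun y : EuclideanSpace ℝ (Fin (Module.finrank ℝ (Fin n → mixedSpace K))) => ‖y‖ ^ 2)
        (f := fun x : Fin n → mixedSpace K => T x) (hasTemperateGrowth_norm_sq _) T.hasTemperateGrowth
    have h1 : (fun x : Fin n → mixedSpace K => (1 + ‖T x‖ ^ 2) ^ k).HasTemperateGrowth :=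
      ((Function.HasTemperateGrowth.const (1 : ℝ)).add h0).pow k
    exact (Function.HasTemperateGrowth.const _).mul h1
  have hBc : Continuous B := continuous_const.mul ((continuous_const.add (T.continuous.norm.pow 2)).pow k)
  have hB0 : ∀ x, 0 ≤ B x := fun x => by positivity
  have hPB : ∀ x, ‖P x‖ ≤ B x := fun x => by
    have ht : 0 ≤ ‖T x‖ := norm_nonneg _
    have h1 : 1 + ‖x‖ ≤ (2 * a) * (1 + ‖T x‖ ^ 2) := by
      nlinarith [hxle x, mul_nonneg (zero_le_one.trans ha1) (sq_nonneg (‖T x‖ - 1)),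
        mul_nonneg (zero_le_one.trans ha1) (sq_nonneg ‖T x‖)]
    have h2 : (1 + ‖x‖) ^ k ≤ ((2 * a) * (1 + ‖T x‖ ^ 2)) ^ k := pow_le_pow_left₀ (by positivity) h1 k
    calc ‖P x‖ ≤ C * (1 + ‖x‖) ^ k := hCb x
      _ ≤ C * ((2 * a) * (1 + ‖T x‖ ^ 2)) ^ k := mul_le_mul_of_nonneg_left h2 hC0
      _ = B x := by simp only [hB, mul_pow, mul_assoc]
  -- the Gaussian Schwartz function pulled back by `T`, and the four pieces
  set Γ : SchwartzMap (Fin n → mixedSpace K) ℂ :=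
    SchwartzMap.compCLMOfContinuousLinearEquiv ℂ T (Literature.Analysis.FunctionSpaces.gaussianSchwartz _ 1) with hΓ
  have hΓa : ∀ x, Γ x = ((G x : ℝ) : ℂ) := fun x => by
    rw [hΓ, SchwartzMap.compCLMOfContinuousLinearEquiv_apply, Function.comp_apply,
      Literature.Analysis.FunctionSpaces.gaussianSchwartz_apply one_pos, neg_mul, one_mul]
  have hre : (fun x => ((((P x).re + B x : ℝ)) : ℂ)).HasTemperateGrowth :=
    Complex.hasTemperateGrowth_ofReal.comp ((Complex.reCLM.hasTemperateGrowth.comp hPt).add hBr)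
  have him : (fun x => ((((P x).im + B x : ℝ)) : ℂ)).HasTemperateGrowth :=
    Complex.hasTemperateGrowth_ofReal.comp ((Complex.imCLM.hasTemperateGrowth.comp hPt).add hBr)
  have hb : (fun x => ((B x : ℝ) : ℂ)).HasTemperateGrowth := Complex.hasTemperateGrowth_ofReal.comp hBr
  -- the common verification
  have piece : ∀ m : (Fin n → mixedSpace K) → ℝ, Continuous m → (∀ x, 0 ≤ m x) →
      (fun x => ((m x : ℝ) : ℂ)).HasTemperateGrowth →
      Continuous (fun z => m (xo z) * G (xo z)) ∧ (∀ z, 0 ≤ m (xo z) * G (xo z)) ∧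
        ∃ S : SchwartzMap (Fin n → mixedSpace K) ℂ, ∀ z : Fin n → InfiniteAdeleRing K,
          (((m (xo z) * G (xo z) : ℝ)) : ℂ) = S fun j => InfiniteAdeleRing.ringEquiv_mixedSpace K (z j) := by
    intro m hmc hm0 hmt
    refine ⟨(hmc.comp hxoc).mul (hGc.comp hxoc), fun z => mul_nonneg (hm0 _) (hG0 _),
      SchwartzMap.smulLeftCLM ℂ (fun x => ((m x : ℝ) : ℂ)) Γ, fun z => ?_⟩
    rw [SchwartzMap.smulLeftCLM_apply_apply hmt, smul_eq_mul, hΓa]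
    push_cast
    rfl
  refine ⟨fun z => ((P (xo z)).re + B (xo z)) * G (xo z), fun z => B (xo z) * G (xo z),
    fun z => ((P (xo z)).im + B (xo z)) * G (xo z), fun z => B (xo z) * G (xo z), ?_, fun z => ?_⟩
  · intro Ψ hΨ
    simp only [List.mem_cons, List.not_mem_nil, or_false] at hΨ
    have hreb : ∀ x, 0 ≤ (P x).re + B x := fun x => by
      have := (abs_le.1 ((Complex.abs_re_le_norm (P x)).trans (hPB x))).1
      linarith
    have himb : ∀ x, 0 ≤ (P x).im + B x := fun x => by
      have := (abs_le.1 ((Complex.abs_im_le_norm (P x)).trans (hPB x))).1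
      linarith
    rcases hΨ with rfl | rfl | rfl | rfl
    · exact piece _ ((Complex.continuous_re.comp hPc).add hBc) hreb hre
    · exact piece _ hBc hB0 hb
    · exact piece _ ((Complex.continuous_im.comp hPc).add hBc) himb him
    · exact piece _ hBc hB0 hb
  · have h1 : Φ z = P (xo z) * ((G (xo z) : ℝ) : ℂ) := hΦ z
    have h2 : P (xo z) = ((P (xo z)).re : ℂ) + ((P (xo z)).im : ℂ) * Complex.I := (Complex.re_add_im _).symm
    rw [h1, h2]
    push_cast
    ring

end PolyGaussian

end Literature.NumberTheory.Automorphic
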